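import Literature.MathematicalPhysics.QuantumFieldTheory.BalabanImbrieJaffe1984to88.BIJ88Regularity561
import Literature.MathematicalPhysics.QuantumFieldTheory.BalabanImbrieJaffe1984to88.BIJ88Theta561Witness

/-!
# `BalabanImbrieJaffe1984to88.BIJ88RemovedFieldBounds286` — T. Bałaban, J. Imbrie, A. Jaffe, *Effective action and cluster properties of the
abelian Higgs model*, Commun. Math. Phys. **114** (1988) 257–315 [BalabanImbrieJaffe1988], p. 286 [PDF 30], the PRINTED INFERENCE behind the
three bounds on the field removed in passing from `u′_k` of (5.5.14) to the new background field `ũ_{k+1}` of (5.6.1), verbatim: *"We then made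
a gauge transformation and removed the small kernel w₁. The gauge transformation does not change the regularity, and ∂w₁, ∂*w₁ are small, so the
bounds remain valid. After another translation we removed the field θ_kH_{k,loc}A^{(k)}. This field satisfies ∂(θ_kH_{k,loc}A^{(k)}) ≦ cp(e_k)
because A^{(k)} ≦ cp(e_k) and because ∂H_{k,loc}, H_{k,loc}, and derivatives of θ_k are bounded. Similarly ∂*(θ_kH_{k,loc}A^{(k)}), θ_kH_{k,loc}A^{(k)}
are bounded by cp(e_k). Thus removing θ_kH_{k,loc}A^{(k)} does not spoil the regularity, and ũ_{k+1} satisfies the regularity condition."* —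
PROVED as the DISCRETE LEIBNIZ RULES for `∂^η(θ·g)`, `∂^{η*}(θ·g)` on the torus carriers of record plus kernel row-sum bounds, DISCHARGING the
three displayed hypotheses `hg`/`hcurl`/`hdiv` of this seat's gen-8 theorem `BIJ88Regularity561.regular286_uTilde561` down to: the regularity of
`u′_k`, `|A^{(k)}| ≦ c_Ap(e_k)` (row `C2.Eq5.9.4`), `|A′| ≦ c_{A′}p(e_k)` (row `C2.Eq5.3.1-5.3.7`, p. 280), row-sum bounds on the kernels `H_{k,loc}`,
`∂^ηH_{k,loc}`, `∂^{η*}H_{k,loc}`, `w₁`, `∂^ηw₁`, `∂^{η*}w₁` (*"bounded"*, *"small"*: rows `C2.Eq5.4.7` / C2 §2, printed claims), and the Lipschitz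
bound on `θ_k` (*"derivatives of θ_k are bounded"*; r16's witness `BIJ88Theta561Witness.abs_theta_sub_theta_le`).

statement-level skeleton of published theorems with citation tags; proofs where landed; nothing here is a claim about the Yang–Mills mass gap

PDF held: `paper:balaban1988-cmp114-bij-abelian-higgs-effective-action` (journal page = PDF page + 256); p. 286 [PDF 30] rendered with the cell's
`g4png.py` and read as an image this session (seat folder `pages/original-p030-x2.png`).

CITATION HEADER (lean-in-tree rule).  Part of the lit-balaban TYPED SKELETON (HOME `run/shared/lean/pub/lit-balaban/`), PHASE-2 proof seat p31
gen 9 (unit `lit-balaban-p31-g9`; TAKING line HOME/STATUS.md 2026-08-21T20:23:44Z).  WHAT IS REPRODUCED: rows `C2.Claim@286` (regularity of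
`ũ_{k+1}`, typed `BIJ88Regularity286.Regular286`, owner r16) and `C2.Eq5.6.1-5.6.2` ((5.6.1) `uTilde561`, `θ_k`) of
`HOME/lit-balaban-r16/ROWS-C2-part2.md`; continues p36 gen 6's `BIJ88Smooth43Phase` §4 (*"The kernels … and their derivatives are bounded, so …"*
for a ONE-level kernel field `KB`) and this seat's gen 8 `BIJ88Regularity561` (regularity of `ũ_{k+1}` from that of `u′_k` + three displayed
bounds on the removed field `g = θ_kH_{k,loc}A^{(k)} + w₁A′`).

THE MECHANISM, made explicit (`∂^η = LatticeFieldCalculus.curl η⁻¹`, `∂^{η*} = diverg η⁻¹` as in r18's (4.3) `Smooth43`; torus level `n`):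
* §1 DISCRETE LEIBNIZ RULES for a product `θ·g` of bond functions (`curl_mul_eq`, `diverg_mul_eq`): with `|θ| ≦ 1`, *"derivatives of θ_k bounded"*
  as `|θ(b) − θ(b′)| ≦ ℓ·dist_∞(b₋, b′₋)` (the form of r16's witness; it makes `θ` a function of the base point) and `|g| ≦ G₀` they give
  `|∂^η(θg)(p)| ≦ |∂^ηg(p)| + 2η⁻¹ℓG₀` (`abs_curl_mul_le`), `|∂^{η*}(θg)(x)| ≦ |∂^{η*}g(x)| + dη⁻¹ℓG₀` (`abs_diverg_mul_le`); for `ℓ = 1/N`, `N = M/η`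
  steps (print's thickness `M = O(1)` in unit scale) the extra terms are `2G₀/M`, `dG₀/M`.
* §2 KERNEL FIELDS `g(b) = Σ_{b′}K(b,b′)A(b′)` over ANY finite index (`H_{k,loc}A^{(k)}`: unit-lattice bonds; `w₁A′`: η-bonds): `∂^η`, `∂^{η*}` pass onto
  the kernel (`curl_kernel₂_apply`, `diverg_kernel₂_apply`; p36's one-level versions verbatim), so row sums `≦ K₀, K₁, K₂` of `K`, `∂^ηK`, `∂^{η*}K` and
  `|A| ≦ M` give `|g|, |∂^ηg|, |∂^{η*}g| ≦ K₀M, K₁M, K₂M` (`kernelField_bounds`); a linear operator between the finite function spaces IS such a kernel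
  field (`linearMap_apply_eq_kernel_sum`) — the bridge to the `→ₗ[ℝ]` currency of `BIJ88Eq5514Torus`; `abs_linearMap_apply_le` (§6) is the per-bond
  size `|H_{k,loc}A^{(k)}(b)| ≦ K₀c_Ap(e_k)` that row `C2.Eq5.9.3` (p02's `passage593_datum'`) consumes.
* §3 THE THREE BOUNDS on `g = θ·H_{k,loc}A^{(k)} + w₁A′`: `|g| ≦ G₀ + V₀`, `|∂^ηg| ≦ G₁ + 2η⁻¹ℓG₀ + V₁`, `|∂^{η*}g| ≦ G₂ + dη⁻¹ℓG₀ + V₂`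
  (`removedField_bounds`; kernel currency `removedField_bounds_of_kernels`, `M = c_Ap(e_k)`, `M′ = c_{A′}p(e_k)`).
* §4 ASSEMBLY: gen 8's `regular286_uTilde561` with `hg`/`hcurl`/`hdiv` DISCHARGED — `regular286_uTilde561_of_fieldBounds`,
  **`regular286_uTilde561_of_kernels`** (explicit `c′ = (K₀(1 + (2+d)η⁻¹ℓ) + K₁ + K₂)c_A + (W₀ + W₁ + W₂)c_{A′}`; *"bounded by cp(e_k)"* ⟹
  `≦ cp(e_k)r(e_k)` by `r(e_k) ≧ 1`), the torus instance `regular286_uTilde561_torus_of_kernels` (`Q = Q^{s*}_{k+1}v` the concrete pull-back, the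
  (5.5.14) field given on the cube bonds as in gen 8), and §5 the instance with r16's witness `θ = BIJ88Theta561Witness.theta N Λ₆`, `ℓ = 1/N`
  (`regular286_uTilde561_theta`).
HONEST SCOPE.  The row-sum bounds on `H_{k,loc}`, `∂^ηH_{k,loc}`, `∂^{η*}H_{k,loc}` (regularity of `H_k`, C2 §2 / [2]) and on `w₁`, `∂w₁`, `∂*w₁`
(p. 282, row `C2.Eq5.4.7`), and `|A^{(k)}| ≦ cp(e_k)` ((5.9.4), a theorem of row `C2.Eq5.9.4` for the cut-off field), `|A′| ≦ cp(e_k)` (p. 280) are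
INPUTS here, displayed as hypotheses on their own rows' data — nothing of [2]'s kernel analysis is asserted.  `A^{(k)}` enters through a GLOBAL
sup bound (the cut-off field `Λ₁^{(k)*}A^{(k)}` is what `H_{k,loc}` reads).  The last sentence of p. 286 (*"the j-th regularity condition for
r(e_k)-cubes"*) is not treated.  Theorems only (no `def`); 0 `sorry`; imports this seat's `BIJ88Regularity561` (p300831) and r16's
`BIJ88Theta561Witness` (p300300).  Unit `lit-balaban-p31` (literature-prover-lit-balaban-p31-g9-0), 2026-08-21.  NOT summit progress.
-/

namespace Literature.MathematicalPhysics.QuantumFieldTheory.BalabanImbrieJaffe1984to88.BIJ88RemovedFieldBounds286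

open Literature.MathematicalPhysics.QuantumFieldTheory.Balaban1983to89
open BIJ88Sect3Statements (U1 toC starB starP)
open BIJ88Regularity286 (Regular286 cubeSites regular286_of_eqOn)
open BIJ88Sect5StatementsPart3 (bgExp uTilde561)
open BIJ88Regularity561 (regular286_uTilde561)
open BIJ88Smooth43Phase (abs_kernel_apply_le)
open BIJ88Theta561Witness (theta theta_nonneg theta_le_one abs_theta_sub_theta_le supDist_src_tgt_le)
open BIJ85Eq453GaugeField (qsstarGIter)
open LatticeFieldCalculus (curl diverg supDist curl_add)
open B3TorusRadialSums (supDist_comm supDist_eq_zero_iff)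
open scoped BigOperators
open Complex Finset

noncomputable section

variable {P : Params} {n : ℕ}

/-! ## §1  Discrete Leibniz rules: «derivatives of θ_k are bounded» -/

/-- kernel: **the discrete Leibniz rule for the plaquette variable of a product** `θ·g` of bond functions — on `p = ⟨x; μ < ν⟩` with bonds
`b₀ = ⟨x,μ⟩`, `b₁ = ⟨x+e_μ,ν⟩`, `b₂ = ⟨x+e_ν,μ⟩`, `b₃ = ⟨x,ν⟩`: `∂(θg)(p) = θ(b₀)∂g(p) + c[(θ(b₁)−θ(b₀))g(b₁) − (θ(b₂)−θ(b₀))g(b₂) − (θ(b₃)−θ(b₀))g(b₃)]`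
(the mechanism of *"∂(θ_kH_{k,loc}A^{(k)}) ≦ cp(e_k) because … ∂H_{k,loc}, H_{k,loc}, and derivatives of θ_k are bounded"*).
[cite: BalabanImbrieJaffe1988, (4.3) p.286] -/
theorem curl_mul_eq (c : ℝ) (θ g : PBond P n → ℝ) (p : Balaban1983to89.Plaq P n) :
    curl c (fun b => θ b * g b) p =
      θ ⟨p.src, p.μ⟩ * curl c g p +
        c * ((θ ⟨p.src.shift p.μ, p.ν⟩ - θ ⟨p.src, p.μ⟩) * g ⟨p.src.shift p.μ, p.ν⟩
              - (θ ⟨p.src.shift p.ν, p.μ⟩ - θ ⟨p.src, p.μ⟩) * g ⟨p.src.shift p.ν, p.μ⟩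
              - (θ ⟨p.src, p.ν⟩ - θ ⟨p.src, p.μ⟩) * g ⟨p.src, p.ν⟩) := by
  simp only [curl, smul_eq_mul]
  ring

/-- kernel: **the discrete Leibniz rule for the divergence of a product** `θ·g`:
`∂*(θg)(x) = Σ_μ [θ(x,μ)·c(g(x−e_μ,μ) − g(x,μ)) + c(θ(x−e_μ,μ) − θ(x,μ))g(x−e_μ,μ)]`. [cite: BalabanImbrieJaffe1988, (4.3) p.286] -/
theorem diverg_mul_eq (c : ℝ) (θ g : PBond P n → ℝ) (x : Balaban1983to89.Site P n) :
    diverg c (fun b => θ b * g b) x =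
      ∑ μ : Fin P.d, (θ ⟨x, μ⟩ * (c * (g ⟨x.unshift μ, μ⟩ - g ⟨x, μ⟩))
        + c * ((θ ⟨x.unshift μ, μ⟩ - θ ⟨x, μ⟩) * g ⟨x.unshift μ, μ⟩)) := by
  simp only [diverg, smul_eq_mul]
  refine Finset.sum_congr rfl fun μ _ => ?_
  ring

/-- kernel: the divergence rule when `θ` takes ONE value `t` on the bonds leaving `x` (a function of the base point, as r16's witness
`BIJ88Theta561Witness.theta`): `∂*(θg)(x) = t·∂*g(x) + c·Σ_μ (θ(x−e_μ,μ) − t)g(x−e_μ,μ)`. [cite: BalabanImbrieJaffe1988, (4.3) p.286] -/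
theorem diverg_mul_eq_of_src (c : ℝ) (θ g : PBond P n → ℝ) (x : Balaban1983to89.Site P n) (t : ℝ) (ht : ∀ μ, θ ⟨x, μ⟩ = t) :
    diverg c (fun b => θ b * g b) x =
      t * diverg c g x + c * ∑ μ : Fin P.d, (θ ⟨x.unshift μ, μ⟩ - t) * g ⟨x.unshift μ, μ⟩ := by
  rw [diverg_mul_eq, Finset.sum_add_distrib]
  simp only [diverg, smul_eq_mul, Finset.mul_sum, ht]

/-- kernel: the end-points of the bond `⟨x − e_μ, x⟩` are at torus distance `≦ 1` (r16's `supDist_src_tgt_le` read backwards).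
[cite: BalabanImbrieJaffe1988, (4.3) p.286] -/
theorem supDist_unshift_le (x : Balaban1983to89.Site P n) (μ : Fin P.d) : supDist (x.unshift μ) x ≤ 1 := by
  have hsu : (x.unshift μ).shift μ = x := by
    funext ν
    by_cases h : ν = μ
    · subst h; simp [Balaban1983to89.Site.shift, Balaban1983to89.Site.unshift]
    · simp [Balaban1983to89.Site.shift, Balaban1983to89.Site.unshift, h]
  have h := supDist_src_tgt_le (⟨x.unshift μ, μ⟩ : PBond P n)
  have ht : (⟨x.unshift μ, μ⟩ : PBond P n).tgt = x := hsu
  rwa [ht] at h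

/-- kernel: `dist_∞(x + e_μ, x) ≦ 1`. [cite: BalabanImbrieJaffe1988, (4.3) p.286] -/
theorem supDist_shift_le (x : Balaban1983to89.Site P n) (μ : Fin P.d) : supDist (x.shift μ) x ≤ 1 := by
  rw [supDist_comm]
  exact supDist_src_tgt_le (⟨x, μ⟩ : PBond P n)

/-- kernel: a bond function with `|θ(b) − θ(b′)| ≦ ℓ·dist_∞(b₋, b′₋)` takes the same value on bonds with the same base point.
[cite: BalabanImbrieJaffe1988, (4.3) p.286] -/
theorem eq_of_lip_of_src_eq {ℓ : ℝ} {θ : PBond P n → ℝ}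
    (hLip : ∀ b b' : PBond P n, |θ b - θ b'| ≤ ℓ * (supDist b.src b'.src : ℝ)) {b b' : PBond P n} (h : b.src = b'.src) :
    θ b = θ b' := by
  have h1 := hLip b b'
  rw [h, (supDist_eq_zero_iff b'.src b'.src).mpr rfl, Nat.cast_zero, mul_zero] at h1
  exact sub_eq_zero.mp (abs_nonpos_iff.mp h1)

/-- kernel: neighbouring base points ⟹ values `ℓ`-close: `|θ(⟨x+e_μ, ·⟩) − θ(⟨x, ·⟩)| ≦ ℓ`. [cite: BalabanImbrieJaffe1988, (4.3) p.286] -/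
theorem abs_sub_le_of_lip_shift {ℓ : ℝ} {θ : PBond P n → ℝ} (hℓ : 0 ≤ ℓ)
    (hLip : ∀ b b' : PBond P n, |θ b - θ b'| ≤ ℓ * (supDist b.src b'.src : ℝ)) (x : Balaban1983to89.Site P n) (μ κ κ' : Fin P.d) :
    |θ ⟨x.shift μ, κ⟩ - θ ⟨x, κ'⟩| ≤ ℓ := by
  have hs : (supDist (x.shift μ) x : ℝ) ≤ 1 := by exact_mod_cast supDist_shift_le x μ
  calc |θ ⟨x.shift μ, κ⟩ - θ ⟨x, κ'⟩| ≤ ℓ * (supDist (x.shift μ) x : ℝ) := hLip ⟨x.shift μ, κ⟩ ⟨x, κ'⟩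
    _ ≤ ℓ * 1 := mul_le_mul_of_nonneg_left hs hℓ
    _ = ℓ := mul_one ℓ

/-- kernel: `|θ(⟨x−e_μ, ·⟩) − θ(⟨x, ·⟩)| ≦ ℓ`. [cite: BalabanImbrieJaffe1988, (4.3) p.286] -/
theorem abs_sub_le_of_lip_unshift {ℓ : ℝ} {θ : PBond P n → ℝ} (hℓ : 0 ≤ ℓ)
    (hLip : ∀ b b' : PBond P n, |θ b - θ b'| ≤ ℓ * (supDist b.src b'.src : ℝ)) (x : Balaban1983to89.Site P n) (μ κ κ' : Fin P.d) :
    |θ ⟨x.unshift μ, κ⟩ - θ ⟨x, κ'⟩| ≤ ℓ := by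
  have hs : (supDist (x.unshift μ) x : ℝ) ≤ 1 := by exact_mod_cast supDist_unshift_le x μ
  calc |θ ⟨x.unshift μ, κ⟩ - θ ⟨x, κ'⟩| ≤ ℓ * (supDist (x.unshift μ) x : ℝ) := hLip ⟨x.unshift μ, κ⟩ ⟨x, κ'⟩
    _ ≤ ℓ * 1 := mul_le_mul_of_nonneg_left hs hℓ
    _ = ℓ := mul_one ℓ

/-- kernel: `|θg| ≦ |g|` for `|θ| ≦ 1` (*"θ_kH_{k,loc}A^{(k)} [is] bounded by cp(e_k)"*). [cite: BalabanImbrieJaffe1988, (4.3) p.286] -/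
theorem abs_mul_le_of_abs_le_one {θ g : PBond P n → ℝ} (hθ : ∀ b, |θ b| ≤ 1) (b : PBond P n) : |θ b * g b| ≤ |g b| := by
  rw [abs_mul]
  exact mul_le_of_le_one_left (abs_nonneg _) (hθ b)

/-- **«∂(θ_kH_{k,loc}A^{(k)}) ≦ cp(e_k) because … and derivatives of θ_k are bounded»** — the PLAQUETTE-VARIABLE estimate of the Leibniz rule:
`|θ| ≦ 1`, `|θ(b) − θ(b′)| ≦ ℓ·dist_∞(b₋,b′₋)` and `|g| ≦ G₀` everywhere give `|∂^c(θg)(p)| ≦ |∂^cg(p)| + 2|c|ℓG₀` on every plaquette (the third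
difference of `curl_mul_eq` vanishes: `b₃` and `b₀` share the base point). [cite: BalabanImbrieJaffe1988, (4.3) p.286] -/
theorem abs_curl_mul_le {c ℓ G₀ : ℝ} {θ g : PBond P n → ℝ} (hθ : ∀ b, |θ b| ≤ 1)
    (hLip : ∀ b b' : PBond P n, |θ b - θ b'| ≤ ℓ * (supDist b.src b'.src : ℝ)) (hℓ : 0 ≤ ℓ) (hg : ∀ b, |g b| ≤ G₀)
    (p : Balaban1983to89.Plaq P n) : |curl c (fun b => θ b * g b) p| ≤ |curl c g p| + 2 * |c| * ℓ * G₀ := by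
  rw [curl_mul_eq]
  have hG : 0 ≤ G₀ := (abs_nonneg _).trans (hg ⟨p.src, p.μ⟩)
  have hd1 : |θ ⟨p.src.shift p.μ, p.ν⟩ - θ ⟨p.src, p.μ⟩| ≤ ℓ := abs_sub_le_of_lip_shift hℓ hLip p.src p.μ p.ν p.μ
  have hd2 : |θ ⟨p.src.shift p.ν, p.μ⟩ - θ ⟨p.src, p.μ⟩| ≤ ℓ := abs_sub_le_of_lip_shift hℓ hLip p.src p.ν p.μ p.μ
  have hd3 : θ ⟨p.src, p.ν⟩ - θ ⟨p.src, p.μ⟩ = 0 := sub_eq_zero.mpr (eq_of_lip_of_src_eq hLip rfl)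
  have h1 : |θ ⟨p.src, p.μ⟩ * curl c g p| ≤ |curl c g p| := by
    rw [abs_mul]; exact mul_le_of_le_one_left (abs_nonneg _) (hθ _)
  have h2 : |(θ ⟨p.src.shift p.μ, p.ν⟩ - θ ⟨p.src, p.μ⟩) * g ⟨p.src.shift p.μ, p.ν⟩| ≤ ℓ * G₀ := by
    rw [abs_mul]; exact mul_le_mul hd1 (hg _) (abs_nonneg _) hℓ
  have h3 : |(θ ⟨p.src.shift p.ν, p.μ⟩ - θ ⟨p.src, p.μ⟩) * g ⟨p.src.shift p.ν, p.μ⟩| ≤ ℓ * G₀ := by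
    rw [abs_mul]; exact mul_le_mul hd2 (hg _) (abs_nonneg _) hℓ
  rw [hd3, zero_mul, sub_zero]
  calc |θ ⟨p.src, p.μ⟩ * curl c g p +
          c * ((θ ⟨p.src.shift p.μ, p.ν⟩ - θ ⟨p.src, p.μ⟩) * g ⟨p.src.shift p.μ, p.ν⟩
              - (θ ⟨p.src.shift p.ν, p.μ⟩ - θ ⟨p.src, p.μ⟩) * g ⟨p.src.shift p.ν, p.μ⟩)|
      ≤ |θ ⟨p.src, p.μ⟩ * curl c g p| +
          |c * ((θ ⟨p.src.shift p.μ, p.ν⟩ - θ ⟨p.src, p.μ⟩) * g ⟨p.src.shift p.μ, p.ν⟩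
              - (θ ⟨p.src.shift p.ν, p.μ⟩ - θ ⟨p.src, p.μ⟩) * g ⟨p.src.shift p.ν, p.μ⟩)| := abs_add_le _ _
    _ ≤ |curl c g p| + |c| * (ℓ * G₀ + ℓ * G₀) := by
        refine add_le_add h1 ?_
        rw [abs_mul]
        exact mul_le_mul_of_nonneg_left ((abs_sub _ _).trans (add_le_add h2 h3)) (abs_nonneg c)
    _ = |curl c g p| + 2 * |c| * ℓ * G₀ := by ring

/-- **«Similarly ∂*(θ_kH_{k,loc}A^{(k)}) … bounded»** — the DIVERGENCE estimate of the Leibniz rule: `|θ| ≦ 1`, `|θ(b) − θ(b′)| ≦ ℓ·dist_∞(b₋,b′₋)`,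
`|g| ≦ G₀` everywhere give `|∂^{c*}(θg)(x)| ≦ |∂^{c*}g(x)| + d|c|ℓG₀` at every site. [cite: BalabanImbrieJaffe1988, (4.3) p.286] -/
theorem abs_diverg_mul_le {c ℓ G₀ : ℝ} {θ g : PBond P n → ℝ} (hθ : ∀ b, |θ b| ≤ 1)
    (hLip : ∀ b b' : PBond P n, |θ b - θ b'| ≤ ℓ * (supDist b.src b'.src : ℝ)) (hℓ : 0 ≤ ℓ) (hg : ∀ b, |g b| ≤ G₀)
    (x : Balaban1983to89.Site P n) : |diverg c (fun b => θ b * g b) x| ≤ |diverg c g x| + P.d * |c| * ℓ * G₀ := by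
  set t : ℝ := θ ⟨x, ⟨0, P.hd⟩⟩ with ht_def
  have ht : ∀ μ, θ ⟨x, μ⟩ = t := fun μ => eq_of_lip_of_src_eq hLip rfl
  rw [diverg_mul_eq_of_src c θ g x t ht]
  have hG : 0 ≤ G₀ := (abs_nonneg _).trans (hg ⟨x, ⟨0, P.hd⟩⟩)
  have h1 : |t * diverg c g x| ≤ |diverg c g x| := by
    rw [abs_mul]; exact mul_le_of_le_one_left (abs_nonneg _) (hθ _)
  have h2 : |∑ μ : Fin P.d, (θ ⟨x.unshift μ, μ⟩ - t) * g ⟨x.unshift μ, μ⟩| ≤ P.d * (ℓ * G₀) := by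
    calc |∑ μ : Fin P.d, (θ ⟨x.unshift μ, μ⟩ - t) * g ⟨x.unshift μ, μ⟩|
        ≤ ∑ μ : Fin P.d, |(θ ⟨x.unshift μ, μ⟩ - t) * g ⟨x.unshift μ, μ⟩| := Finset.abs_sum_le_sum_abs _ _
      _ ≤ ∑ _μ : Fin P.d, ℓ * G₀ := Finset.sum_le_sum fun μ _ => by
          rw [abs_mul]
          exact mul_le_mul (abs_sub_le_of_lip_unshift hℓ hLip x μ μ ⟨0, P.hd⟩) (hg _) (abs_nonneg _) hℓ
      _ = P.d * (ℓ * G₀) := by simp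
  calc |t * diverg c g x + c * ∑ μ : Fin P.d, (θ ⟨x.unshift μ, μ⟩ - t) * g ⟨x.unshift μ, μ⟩|
      ≤ |t * diverg c g x| + |c * ∑ μ : Fin P.d, (θ ⟨x.unshift μ, μ⟩ - t) * g ⟨x.unshift μ, μ⟩| := abs_add_le _ _
    _ ≤ |diverg c g x| + |c| * (P.d * (ℓ * G₀)) := by
        refine add_le_add h1 ?_
        rw [abs_mul]
        exact mul_le_mul_of_nonneg_left h2 (abs_nonneg c)
    _ = |diverg c g x| + P.d * |c| * ℓ * G₀ := by ring

/-! ## §2  Two-level kernel fields: «∂H_{k,loc}, H_{k,loc} … are bounded», «∂w₁, ∂*w₁ are small» -/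

/-- kernel: the plaquette variable of a two-level kernel field is the kernel field of the DIFFERENTIATED kernel, `∂(KA)(p) = Σ_{b′}(∂K(·,b′))(p)A(b′)`
(`b′` over any finite index — the unit-lattice bonds for `H_{k,loc}A^{(k)}`; p36's one-level `BIJ88Smooth43Phase.curl_kernel_apply` verbatim).
[cite: BalabanImbrieJaffe1988, (4.3) p.286] -/
theorem curl_kernel₂_apply {β : Type*} [Fintype β] (c : ℝ) (K : PBond P n → β → ℝ) (A : β → ℝ) (p : Balaban1983to89.Plaq P n) :
    curl c (fun b => ∑ b', K b b' * A b') p = ∑ b', curl c (fun b => K b b') p * A b' := by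
  simp only [curl, smul_eq_mul, Finset.mul_sum, ← Finset.sum_add_distrib, ← Finset.sum_sub_distrib]
  refine Finset.sum_congr rfl fun b' _ => ?_
  ring

/-- kernel: the divergence of a two-level kernel field, `∂*(KA)(x) = Σ_{b′}(∂*K(·,b′))(x)A(b′)`. [cite: BalabanImbrieJaffe1988, (4.3) p.286] -/
theorem diverg_kernel₂_apply {β : Type*} [Fintype β] (c : ℝ) (K : PBond P n → β → ℝ) (A : β → ℝ) (x : Balaban1983to89.Site P n) :
    diverg c (fun b => ∑ b', K b b' * A b') x = ∑ b', diverg c (fun b => K b b') x * A b' := by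
  simp only [diverg, smul_eq_mul, Finset.mul_sum, ← Finset.sum_sub_distrib]
  rw [Finset.sum_comm]
  refine Finset.sum_congr rfl fun b' _ => ?_
  rw [Finset.sum_mul]
  refine Finset.sum_congr rfl fun μ _ => ?_
  ring

/-- **«A^{(k)} ≦ cp(e_k) and … ∂H_{k,loc}, H_{k,loc} … are bounded»** ⟹ the kernel field and its derivatives are bounded: row sums `≦ K₀` of `K`,
`≦ K₁` of `∂^cK`, `≦ K₂` of `∂^{c*}K` and `|A| ≦ M` give `|KA| ≦ K₀M`, `|∂^c(KA)| ≦ K₁M`, `|∂^{c*}(KA)| ≦ K₂M` everywhere.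
[cite: BalabanImbrieJaffe1988, (4.3) p.286] -/
theorem kernelField_bounds {β : Type*} [Fintype β] {c M K₀ K₁ K₂ : ℝ} {K : PBond P n → β → ℝ} {A : β → ℝ} (hM : 0 ≤ M)
    (hA : ∀ b', |A b'| ≤ M) (hK₀ : ∀ b, ∑ b', |K b b'| ≤ K₀) (hK₁ : ∀ p, ∑ b', |curl c (fun b => K b b') p| ≤ K₁)
    (hK₂ : ∀ x, ∑ b', |diverg c (fun b => K b b') x| ≤ K₂) :
    (∀ b, |∑ b', K b b' * A b'| ≤ K₀ * M) ∧ (∀ p, |curl c (fun b => ∑ b', K b b' * A b') p| ≤ K₁ * M) ∧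
      ∀ x, |diverg c (fun b => ∑ b', K b b' * A b') x| ≤ K₂ * M := by
  refine ⟨fun b => abs_kernel_apply_le hA (hK₀ b) hM, fun p => ?_, fun x => ?_⟩
  · rw [curl_kernel₂_apply]; exact abs_kernel_apply_le hA (hK₁ p) hM
  · rw [diverg_kernel₂_apply]; exact abs_kernel_apply_le hA (hK₂ x) hM

open Classical in
/-- kernel: **a linear operator between the finite function spaces IS a kernel field** — `(TA)(b) = Σ_{b′} T(δ_{b′})(b)·A(b′)` with the matrix
elements `T(δ_{b′})(b)` (the bridge from the `→ₗ[ℝ]` currency of `H_{k,loc}`, `𝒟^η_{k+1,loc}` in `BIJ88Eq5514Torus` to the kernel bounds of print).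
[cite: BalabanImbrieJaffe1988, (4.3) p.286] -/
theorem linearMap_apply_eq_kernel_sum {α β : Type*} [Fintype β] (T : (β → ℝ) →ₗ[ℝ] (α → ℝ)) (A : β → ℝ) (b : α) :
    T A b = ∑ b', T (fun j => if b' = j then (1 : ℝ) else 0) b * A b' := by
  have hA : A = ∑ b', A b' • (fun j => if b' = j then (1 : ℝ) else 0) := pi_eq_sum_univ A
  calc T A b = T (∑ b', A b' • fun j => if b' = j then (1 : ℝ) else 0) b := by rw [← hA]
    _ = (∑ b', T (A b' • fun j => if b' = j then (1 : ℝ) else 0)) b := by rw [map_sum]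
    _ = ∑ b', T (A b' • fun j => if b' = j then (1 : ℝ) else 0) b := Finset.sum_apply _ _ _
    _ = ∑ b', T (fun j => if b' = j then (1 : ℝ) else 0) b * A b' :=
        Finset.sum_congr rfl fun b' _ => by rw [map_smul, Pi.smul_apply, smul_eq_mul, mul_comm]

/-! ## §3  The three bounds on the removed field `g = θ_kH_{k,loc}A^{(k)} + w₁A′` -/

/-- kernel: `∂*` is additive (r18's `LatticeFieldCalculus.diverg_sub` restated for sums). [cite: Balaban1984PropagatorsI, (1.21) p.21] -/
theorem diverg_add (c : ℝ) (A B : VecField P n ℝ) (x : Balaban1983to89.Site P n) :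
    diverg c (fun b => A b + B b) x = diverg c A x + diverg c B x := by
  have h := congrFun (LatticeFieldCalculus.diverg_sub c (fun b => A b + B b) B) x
  simp only [add_sub_cancel_right] at h
  linarith

/-- **THE THREE BOUNDS, field level.**  If `|θ| ≦ 1`, `|θ(b) − θ(b′)| ≦ ℓ·dist_∞(b₋,b′₋)` (*"derivatives of θ_k are bounded"*), the field
`HA = H_{k,loc}A^{(k)}` satisfies `|HA| ≦ G₀`, `|∂^ηHA| ≦ G₁`, `|∂^{η*}HA| ≦ G₂` (*"A^{(k)} ≦ cp(e_k) and … ∂H_{k,loc}, H_{k,loc} … bounded"*) and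
`wA = w₁A′` satisfies `|wA| ≦ V₀`, `|∂^ηwA| ≦ V₁`, `|∂^{η*}wA| ≦ V₂` (*"∂w₁, ∂*w₁ are small"*), then the removed field `g = θ·HA + wA` obeys
`|g| ≦ G₀ + V₀`, `|∂^ηg| ≦ G₁ + 2η⁻¹ℓG₀ + V₁`, `|∂^{η*}g| ≦ G₂ + dη⁻¹ℓG₀ + V₂` (with `|η⁻¹|`; `∂^η = curl η⁻¹`, `∂^{η*} = diverg η⁻¹`).
[cite: BalabanImbrieJaffe1988, (4.3) p.286] -/
theorem removedField_bounds {η ℓ G₀ G₁ G₂ V₀ V₁ V₂ : ℝ} {θ HA wA : PBond P n → ℝ} (hθ : ∀ b, |θ b| ≤ 1)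
    (hLip : ∀ b b' : PBond P n, |θ b - θ b'| ≤ ℓ * (supDist b.src b'.src : ℝ)) (hℓ : 0 ≤ ℓ)
    (hHA : ∀ b, |HA b| ≤ G₀) (hHA₁ : ∀ p, |curl η⁻¹ HA p| ≤ G₁) (hHA₂ : ∀ x, |diverg η⁻¹ HA x| ≤ G₂)
    (hwA : ∀ b, |wA b| ≤ V₀) (hwA₁ : ∀ p, |curl η⁻¹ wA p| ≤ V₁) (hwA₂ : ∀ x, |diverg η⁻¹ wA x| ≤ V₂) :
    (∀ b, |θ b * HA b + wA b| ≤ G₀ + V₀) ∧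
      (∀ p, |curl η⁻¹ (fun b => θ b * HA b + wA b) p| ≤ G₁ + 2 * |η⁻¹| * ℓ * G₀ + V₁) ∧
        ∀ x, |diverg η⁻¹ (fun b => θ b * HA b + wA b) x| ≤ G₂ + P.d * |η⁻¹| * ℓ * G₀ + V₂ := by
  refine ⟨fun b => ?_, fun p => ?_, fun x => ?_⟩
  · exact (abs_add_le _ _).trans (add_le_add ((abs_mul_le_of_abs_le_one hθ b).trans (hHA b)) (hwA b))
  · rw [curl_add η⁻¹ (fun b => θ b * HA b) wA p]
    calc |curl η⁻¹ (fun b => θ b * HA b) p + curl η⁻¹ wA p|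
        ≤ |curl η⁻¹ (fun b => θ b * HA b) p| + |curl η⁻¹ wA p| := abs_add_le _ _
      _ ≤ (|curl η⁻¹ HA p| + 2 * |η⁻¹| * ℓ * G₀) + V₁ := add_le_add (abs_curl_mul_le hθ hLip hℓ hHA p) (hwA₁ p)
      _ ≤ (G₁ + 2 * |η⁻¹| * ℓ * G₀) + V₁ := by linarith [hHA₁ p]
      _ = G₁ + 2 * |η⁻¹| * ℓ * G₀ + V₁ := by ring
  · rw [diverg_add η⁻¹ (fun b => θ b * HA b) wA x]
    calc |diverg η⁻¹ (fun b => θ b * HA b) x + diverg η⁻¹ wA x|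
        ≤ |diverg η⁻¹ (fun b => θ b * HA b) x| + |diverg η⁻¹ wA x| := abs_add_le _ _
      _ ≤ (|diverg η⁻¹ HA x| + P.d * |η⁻¹| * ℓ * G₀) + V₂ := add_le_add (abs_diverg_mul_le hθ hLip hℓ hHA x) (hwA₂ x)
      _ ≤ (G₂ + P.d * |η⁻¹| * ℓ * G₀) + V₂ := by linarith [hHA₂ x]
      _ = G₂ + P.d * |η⁻¹| * ℓ * G₀ + V₂ := by ring

/-- **THE THREE BOUNDS, kernel level** — the two sentences end to end: `|A^{(k)}| ≦ M` (print: `cp(e_k)`), `|A′| ≦ M′` (p. 280: `cp(e_k)`), row sums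
of `H_{k,loc}`, `∂^ηH_{k,loc}`, `∂^{η*}H_{k,loc}` bounded by `K₀, K₁, K₂`, of `w₁`, `∂^ηw₁`, `∂^{η*}w₁` by `W₀, W₁, W₂`, `|θ_k| ≦ 1` with Lipschitz
constant `ℓ` ⟹ for `g = θ_k·H_{k,loc}A^{(k)} + w₁A′`: `|g| ≦ K₀M + W₀M′`, `|∂^ηg| ≦ (K₁ + 2η⁻¹ℓK₀)M + W₁M′`, `|∂^{η*}g| ≦ (K₂ + dη⁻¹ℓK₀)M + W₂M′`.
[cite: BalabanImbrieJaffe1988, (4.3) p.286] -/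
theorem removedField_bounds_of_kernels {β β' : Type*} [Fintype β] [Fintype β'] {η ℓ M M' K₀ K₁ K₂ W₀ W₁ W₂ : ℝ}
    {θ : PBond P n → ℝ} {K : PBond P n → β → ℝ} {A : β → ℝ} {W : PBond P n → β' → ℝ} {A' : β' → ℝ}
    (hθ : ∀ b, |θ b| ≤ 1) (hLip : ∀ b b' : PBond P n, |θ b - θ b'| ≤ ℓ * (supDist b.src b'.src : ℝ)) (hℓ : 0 ≤ ℓ)
    (hM : 0 ≤ M) (hA : ∀ b', |A b'| ≤ M) (hK₀ : ∀ b, ∑ b', |K b b'| ≤ K₀)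
    (hK₁ : ∀ p, ∑ b', |curl η⁻¹ (fun b => K b b') p| ≤ K₁) (hK₂ : ∀ x, ∑ b', |diverg η⁻¹ (fun b => K b b') x| ≤ K₂)
    (hM' : 0 ≤ M') (hA' : ∀ b', |A' b'| ≤ M') (hW₀ : ∀ b, ∑ b', |W b b'| ≤ W₀)
    (hW₁ : ∀ p, ∑ b', |curl η⁻¹ (fun b => W b b') p| ≤ W₁) (hW₂ : ∀ x, ∑ b', |diverg η⁻¹ (fun b => W b b') x| ≤ W₂) :
    (∀ b, |θ b * (∑ b', K b b' * A b') + ∑ b', W b b' * A' b'| ≤ K₀ * M + W₀ * M') ∧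
      (∀ p, |curl η⁻¹ (fun b => θ b * (∑ b', K b b' * A b') + ∑ b', W b b' * A' b') p| ≤
          (K₁ + 2 * |η⁻¹| * ℓ * K₀) * M + W₁ * M') ∧
        ∀ x, |diverg η⁻¹ (fun b => θ b * (∑ b', K b b' * A b') + ∑ b', W b b' * A' b') x| ≤
          (K₂ + P.d * |η⁻¹| * ℓ * K₀) * M + W₂ * M' := by
  obtain ⟨hG₀, hG₁, hG₂⟩ := kernelField_bounds (c := η⁻¹) hM hA hK₀ hK₁ hK₂
  obtain ⟨hV₀, hV₁, hV₂⟩ := kernelField_bounds (c := η⁻¹) hM' hA' hW₀ hW₁ hW₂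
  obtain ⟨h0, h1, h2⟩ := removedField_bounds (η := η) hθ hLip hℓ hG₀ hG₁ hG₂ hV₀ hV₁ hV₂
  refine ⟨fun b => h0 b, fun p => (h1 p).trans (le_of_eq (by ring)), fun x => (h2 x).trans (le_of_eq (by ring))⟩

/-! ## §4  «Thus removing θ_kH_{k,loc}A^{(k)} does not spoil the regularity» — gen 8's hypotheses discharged -/

/-- **The regularity of `ũ_{k+1}`, field-level inputs.**  The (5.5.14) field `u′_k = (Q^{s*}_{k+1}v)exp ie_kη[H_{k,loc}A^{(k)} − L^{−2}DXf + w₁A′]`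
regular on a family `G` of `r(e_k)`-cubes with constant `c` (r16's `Regular286`), `θ_k` with `|θ_k| ≦ 1` and Lipschitz constant `ℓ`, the field-level
bounds `G_i` on `H_{k,loc}A^{(k)}` and `V_i` on `w₁A′`, and three side conditions placing the Leibniz bounds under `c′p(e_k)r(e_k)` ⟹ the (5.6.1)
field `ũ_{k+1}` is regular on `G` with constant `c + c′` (gen 8's `regular286_uTilde561`, its `hg`/`hcurl`/`hdiv` supplied by `removedField_bounds`).
[cite: BalabanImbrieJaffe1988, (4.3) p.286] -/
theorem regular286_uTilde561_of_fieldBounds {γ : Type*} {cube : Balaban1983to89.Site P n → γ} {G : Set γ}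
    {ek η c c' pek rek ℓ G₀ G₁ G₂ V₀ V₁ V₂ : ℝ} (L : ℝ) {Q : PBond P n → ℂ} {θ HA DXf wA : PBond P n → ℝ}
    (h : Regular286 cube G ek η c pek rek (bgExp ek η Q (fun b => HA b - L⁻¹ ^ 2 * DXf b + wA b)))
    (hθ : ∀ b, |θ b| ≤ 1) (hLip : ∀ b b' : PBond P n, |θ b - θ b'| ≤ ℓ * (supDist b.src b'.src : ℝ)) (hℓ : 0 ≤ ℓ)
    (hHA : ∀ b, |HA b| ≤ G₀) (hHA₁ : ∀ p, |curl η⁻¹ HA p| ≤ G₁) (hHA₂ : ∀ x, |diverg η⁻¹ HA x| ≤ G₂)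
    (hwA : ∀ b, |wA b| ≤ V₀) (hwA₁ : ∀ p, |curl η⁻¹ wA p| ≤ V₁) (hwA₂ : ∀ x, |diverg η⁻¹ wA x| ≤ V₂)
    (h₀ : G₀ + V₀ ≤ c' * pek * rek) (h₁ : G₁ + 2 * |η⁻¹| * ℓ * G₀ + V₁ ≤ c' * pek * rek)
    (h₂ : G₂ + P.d * |η⁻¹| * ℓ * G₀ + V₂ ≤ c' * pek * rek) :
    Regular286 cube G ek η (c + c') pek rek (uTilde561 ek η L Q θ HA DXf) := by
  obtain ⟨hb, hp, hx⟩ := removedField_bounds (η := η) hθ hLip hℓ hHA hHA₁ hHA₂ hwA hwA₁ hwA₂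
  exact regular286_uTilde561 L h (fun _ _ b _ => (hb b).trans h₀) (fun _ _ p _ => (hp p).trans h₁) (fun _ _ x _ => (hx x).trans h₂)


/-- kernel: a row-sum bound is nonnegative. [cite: BalabanImbrieJaffe1988, (4.3) p.286] -/
theorem nonneg_of_rowSum_le {β : Type*} [Fintype β] {f : β → ℝ} {K₀ : ℝ} (h : ∑ b', |f b'| ≤ K₀) : 0 ≤ K₀ :=
  (Finset.sum_nonneg fun _ _ => abs_nonneg _).trans h

/-- kernel (arithmetic of *"bounded by cp(e_k)"* ⟹ `≦ c′p(e_k)r(e_k)`): `0 ≦ X ≦ c′`, `p ≧ 0`, `r ≧ 1` ⟹ `Xp ≦ c′pr`.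
[cite: BalabanImbrieJaffe1988, (4.3) p.286] -/
theorem mul_le_mul_mul_of_le {X c' p r : ℝ} (hp : 0 ≤ p) (hr : 1 ≤ r) (hX : 0 ≤ X) (hXc : X ≤ c') : X * p ≤ c' * p * r := by
  have hcp : 0 ≤ c' * p := mul_nonneg (hX.trans hXc) hp
  calc X * p ≤ c' * p := mul_le_mul_of_nonneg_right hXc hp
    _ = c' * p * 1 := (mul_one _).symm
    _ ≤ c' * p * r := mul_le_mul_of_nonneg_left hr hcp

/-- **THE TWO SENTENCES END TO END: the regularity of `ũ_{k+1}` from that of `u′_k` and the PRINTED DATA.**  With `HA = H_{k,loc}A^{(k)}` and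
`wA = w₁A′` written as kernel fields (`K`, `W` over any finite index types), `|A^{(k)}| ≦ c_Ap(e_k)`, `|A′| ≦ c_{A′}p(e_k)`, row sums of `K`, `∂^ηK`,
`∂^{η*}K` bounded by `K₀, K₁, K₂` and of `W`, `∂^ηW`, `∂^{η*}W` by `W₀, W₁, W₂` (`K₁, W₁ ≧ 0` asked — automatic from the row sums once a plaquette
exists, i.e. `d ≧ 2`), `|θ_k| ≦ 1` with Lipschitz constant `ℓ ≧ 0`, `c_A, c_{A′}, p(e_k) ≧ 0`, `r(e_k) ≧ 1`:
`Regular286 … c … u′_k ⟹ Regular286 … (c + c′) … ũ_{k+1}` with `c′ = (K₀(1 + (2+d)|η⁻¹|ℓ) + K₁ + K₂)c_A + (W₀ + W₁ + W₂)c_{A′}`.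
[cite: BalabanImbrieJaffe1988, (4.3) p.286] -/
theorem regular286_uTilde561_of_kernels {γ β β' : Type*} [Fintype β] [Fintype β'] {cube : Balaban1983to89.Site P n → γ} {G : Set γ}
    {ek η c pek rek ℓ cA cA' K₀ K₁ K₂ W₀ W₁ W₂ : ℝ} (L : ℝ) {Q : PBond P n → ℂ} {θ DXf : PBond P n → ℝ}
    {K : PBond P n → β → ℝ} {A : β → ℝ} {W : PBond P n → β' → ℝ} {A' : β' → ℝ}
    (h : Regular286 cube G ek η c pek rek
      (bgExp ek η Q (fun b => (∑ b', K b b' * A b') - L⁻¹ ^ 2 * DXf b + ∑ b', W b b' * A' b')))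
    (hθ : ∀ b, |θ b| ≤ 1) (hLip : ∀ b b' : PBond P n, |θ b - θ b'| ≤ ℓ * (supDist b.src b'.src : ℝ)) (hℓ : 0 ≤ ℓ)
    (hp : 0 ≤ pek) (hr : 1 ≤ rek) (hcA : 0 ≤ cA) (hcA' : 0 ≤ cA') (hK₁' : 0 ≤ K₁) (hW₁' : 0 ≤ W₁)
    (hA : ∀ b', |A b'| ≤ cA * pek) (hK₀ : ∀ b, ∑ b', |K b b'| ≤ K₀)
    (hK₁ : ∀ p, ∑ b', |curl η⁻¹ (fun b => K b b') p| ≤ K₁) (hK₂ : ∀ x, ∑ b', |diverg η⁻¹ (fun b => K b b') x| ≤ K₂)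
    (hA' : ∀ b', |A' b'| ≤ cA' * pek) (hW₀ : ∀ b, ∑ b', |W b b'| ≤ W₀)
    (hW₁ : ∀ p, ∑ b', |curl η⁻¹ (fun b => W b b') p| ≤ W₁) (hW₂ : ∀ x, ∑ b', |diverg η⁻¹ (fun b => W b b') x| ≤ W₂) :
    Regular286 cube G ek η (c + ((K₀ * (1 + (2 + P.d) * |η⁻¹| * ℓ) + K₁ + K₂) * cA + (W₀ + W₁ + W₂) * cA')) pek rek
      (uTilde561 ek η L Q θ (fun b => ∑ b', K b b' * A b') DXf) := by
  have hM : 0 ≤ cA * pek := mul_nonneg hcA hp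
  have hM' : 0 ≤ cA' * pek := mul_nonneg hcA' hp
  obtain ⟨hb, hpl, hx⟩ := kernelField_bounds (c := η⁻¹) hM hA hK₀ hK₁ hK₂
  obtain ⟨hwb, hwp, hwx⟩ := kernelField_bounds (c := η⁻¹) hM' hA' hW₀ hW₁ hW₂
  -- the row-sum bounds the torus makes visible are nonnegative (a bond and a site always exist)
  have hK₀' : 0 ≤ K₀ := nonneg_of_rowSum_le (hK₀ ⟨default, ⟨0, P.hd⟩⟩)
  have hK₂' : 0 ≤ K₂ := nonneg_of_rowSum_le (hK₂ default)
  have hW₀' : 0 ≤ W₀ := nonneg_of_rowSum_le (hW₀ ⟨default, ⟨0, P.hd⟩⟩)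
  have hW₂' : 0 ≤ W₂ := nonneg_of_rowSum_le (hW₂ default)
  have hd : (0 : ℝ) ≤ P.d := Nat.cast_nonneg _
  have ha : 0 ≤ |η⁻¹| := abs_nonneg _
  have t0 : 0 ≤ K₀ * cA := mul_nonneg hK₀' hcA
  have t1 : 0 ≤ K₁ * cA := mul_nonneg hK₁' hcA
  have t2 : 0 ≤ K₂ * cA := mul_nonneg hK₂' hcA
  have t3 : 0 ≤ W₀ * cA' := mul_nonneg hW₀' hcA'
  have t4 : 0 ≤ W₁ * cA' := mul_nonneg hW₁' hcA'
  have t5 : 0 ≤ W₂ * cA' := mul_nonneg hW₂' hcA'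
  have t6 : 0 ≤ |η⁻¹| * ℓ * (K₀ * cA) := mul_nonneg (mul_nonneg ha hℓ) t0
  have t7 : 0 ≤ (P.d : ℝ) * (|η⁻¹| * ℓ * (K₀ * cA)) := mul_nonneg hd t6
  refine regular286_uTilde561_of_fieldBounds (HA := fun b => ∑ b', K b b' * A b') (wA := fun b => ∑ b', W b b' * A' b')
    L h hθ hLip hℓ hb hpl hx hwb hwp hwx ?_ ?_ ?_
  · have e : K₀ * (cA * pek) + W₀ * (cA' * pek) = (K₀ * cA + W₀ * cA') * pek := by ring
    rw [e]
    exact mul_le_mul_mul_of_le hp hr (by linarith) (by linarith)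
  · have e : K₁ * (cA * pek) + 2 * |η⁻¹| * ℓ * (K₀ * (cA * pek)) + W₁ * (cA' * pek) =
        (K₁ * cA + 2 * (|η⁻¹| * ℓ * (K₀ * cA)) + W₁ * cA') * pek := by ring
    rw [e]
    exact mul_le_mul_mul_of_le hp hr (by linarith) (by linarith)
  · have e : K₂ * (cA * pek) + P.d * |η⁻¹| * ℓ * (K₀ * (cA * pek)) + W₂ * (cA' * pek) =
        (K₂ * cA + P.d * (|η⁻¹| * ℓ * (K₀ * cA)) + W₂ * cA') * pek := by ring
    rw [e]
    exact mul_le_mul_mul_of_le hp hr (by linarith) (by linarith)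

/-- **The torus instance** (continuing gen 8's `BIJ88Regularity561.regular286_uTilde561_torus`).  On the η-lattice torus (level `i`), `Q = Q^{s*}_{k+1}v`
the concrete `(k+1)`-fold pull-back `qsstarGIter (k+1) v` read in `ℂ`; `H_{k,loc}` given by its KERNEL `Hk(b, b′)` (`b′` over the unit-lattice
bonds, level `i + k`), `A = A^{(k)}` with `|A^{(k)}| ≦ c_Ap(e_k)`, `w₁` by its kernel `W`, `A′` with `|A′| ≦ c_{A′}p(e_k)`, `DXf = 𝒟^η_{k+1,loc}∂*Q^{e*}_{k+1}f`
(any bond function — it is not removed), `θ_k` with `|θ_k| ≦ 1` and Lipschitz constant `ℓ`; the background field after both translations and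
the gauge transformation is ANY `U′` agreeing ON THE BONDS OF THE CUBES of `G` with the (5.5.14) form (what `BIJ88Eq5514Torus.eq5514_torus` provides
bond by bond).  If `U′` is `Regular286` on `G` with constant `c`, then `ũ_{k+1}` of (5.6.1) is `Regular286` on `G` with constant `c + c′`, `c′` the
explicit constant of `regular286_uTilde561_of_kernels`. [cite: BalabanImbrieJaffe1988, (4.3) p.286] -/
theorem regular286_uTilde561_torus_of_kernels {i k : ℕ} {γ β' : Type*} [Fintype β'] {cube : Balaban1983to89.Site P i → γ} {G : Set γ}
    {ek η c pek rek ℓ cA cA' K₀ K₁ K₂ W₀ W₁ W₂ : ℝ} (L : ℝ) (v : GaugeField P (i + k + 1) U1)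
    (Hk : PBond P i → PBond P (i + k) → ℝ) (A : PBond P (i + k) → ℝ) (DXf θ : PBond P i → ℝ) (W : PBond P i → β' → ℝ) (A' : β' → ℝ)
    {U' : PBond P i → ℂ}
    (hEq : ∀ q ∈ G, ∀ b ∈ starB (cubeSites cube q),
      U' b = bgExp ek η (fun b => toC (qsstarGIter (k + 1) v b))
        (fun b => (∑ b', Hk b b' * A b') - L⁻¹ ^ 2 * DXf b + ∑ b', W b b' * A' b') b)
    (hU : Regular286 cube G ek η c pek rek U')
    (hθ : ∀ b, |θ b| ≤ 1) (hLip : ∀ b b' : PBond P i, |θ b - θ b'| ≤ ℓ * (supDist b.src b'.src : ℝ)) (hℓ : 0 ≤ ℓ)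
    (hp : 0 ≤ pek) (hr : 1 ≤ rek) (hcA : 0 ≤ cA) (hcA' : 0 ≤ cA') (hK₁' : 0 ≤ K₁) (hW₁' : 0 ≤ W₁)
    (hA : ∀ b', |A b'| ≤ cA * pek) (hK₀ : ∀ b, ∑ b', |Hk b b'| ≤ K₀)
    (hK₁ : ∀ p, ∑ b', |curl η⁻¹ (fun b => Hk b b') p| ≤ K₁) (hK₂ : ∀ x, ∑ b', |diverg η⁻¹ (fun b => Hk b b') x| ≤ K₂)
    (hA' : ∀ b', |A' b'| ≤ cA' * pek) (hW₀ : ∀ b, ∑ b', |W b b'| ≤ W₀)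
    (hW₁ : ∀ p, ∑ b', |curl η⁻¹ (fun b => W b b') p| ≤ W₁) (hW₂ : ∀ x, ∑ b', |diverg η⁻¹ (fun b => W b b') x| ≤ W₂) :
    Regular286 cube G ek η (c + ((K₀ * (1 + (2 + P.d) * |η⁻¹| * ℓ) + K₁ + K₂) * cA + (W₀ + W₁ + W₂) * cA')) pek rek
      (uTilde561 ek η L (fun b => toC (qsstarGIter (k + 1) v b)) θ (fun b => ∑ b', Hk b b' * A b') DXf) := by
  have h' : Regular286 cube G ek η c pek rek (bgExp ek η (fun b => toC (qsstarGIter (k + 1) v b))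
      (fun b => (∑ b', Hk b b' * A b') - L⁻¹ ^ 2 * DXf b + ∑ b', W b b' * A' b')) :=
    regular286_of_eqOn (fun q hq b hb => (hEq q hq b hb).symm) hU
  exact regular286_uTilde561_of_kernels L h' hθ hLip hℓ hp hr hcA hcA' hK₁' hW₁' hA hK₀ hK₁ hK₂ hA' hW₀ hW₁ hW₂

/-! ## §5  With r16's witness `θ_k` (`BIJ88Theta561Witness.theta`): «derivatives of θ_k are bounded» as `ℓ = 1/N` -/

/-- kernel: `|θ_k| ≦ 1` for r16's witness (`0 ≦ θ ≦ 1`). [cite: BalabanImbrieJaffe1988, (5.6.1) p.285] -/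
theorem abs_theta_le_one (N : ℕ) (Λ6 : Finset (Balaban1983to89.Site P n)) (b : PBond P n) : |theta N Λ6 b| ≤ 1 :=
  abs_le.mpr ⟨by linarith [theta_nonneg N Λ6 b], theta_le_one N Λ6 b⟩

/-- kernel: the Lipschitz bound of r16's witness in the form used here, `|θ(b) − θ(b′)| ≦ N⁻¹·dist_∞(b₋, b′₋)` (*"changes smoothly from 0 to 1 in
a neighborhood … of thickness M"*, `N = M/η` lattice steps). [cite: BalabanImbrieJaffe1988, (5.6.1) p.285] -/
theorem lip_theta {N : ℕ} (hN : 0 < N) (Λ6 : Finset (Balaban1983to89.Site P n)) (b b' : PBond P n) :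
    |theta N Λ6 b - theta N Λ6 b'| ≤ (N : ℝ)⁻¹ * (supDist b.src b'.src : ℝ) := by
  rw [inv_mul_eq_div]
  exact abs_theta_sub_theta_le hN Λ6 b b'

/-- **The regularity of `ũ_{k+1}` with the witness `θ_k` of `BIJ88Theta561Witness`** (collar thickness `N` lattice steps): the kernel-level
theorem with `|θ_k| ≦ 1` and `ℓ = N⁻¹` DISCHARGED (`abs_theta_le_one`, `lip_theta`), so the derivative-of-`θ_k` contributions to `c′` read
`K₀(2 + d)|η⁻¹|N⁻¹c_A = K₀(2 + d)c_A/M` for `N = M/η`. [cite: BalabanImbrieJaffe1988, (4.3) p.286] -/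
theorem regular286_uTilde561_theta {γ β β' : Type*} [Fintype β] [Fintype β'] {cube : Balaban1983to89.Site P n → γ} {G : Set γ}
    {ek η c pek rek cA cA' K₀ K₁ K₂ W₀ W₁ W₂ : ℝ} {N : ℕ} (hN : 0 < N) (Λ6 : Finset (Balaban1983to89.Site P n)) (L : ℝ)
    {Q : PBond P n → ℂ} {DXf : PBond P n → ℝ} {K : PBond P n → β → ℝ} {A : β → ℝ} {W : PBond P n → β' → ℝ} {A' : β' → ℝ}
    (h : Regular286 cube G ek η c pek rek
      (bgExp ek η Q (fun b => (∑ b', K b b' * A b') - L⁻¹ ^ 2 * DXf b + ∑ b', W b b' * A' b')))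
    (hp : 0 ≤ pek) (hr : 1 ≤ rek) (hcA : 0 ≤ cA) (hcA' : 0 ≤ cA') (hK₁' : 0 ≤ K₁) (hW₁' : 0 ≤ W₁)
    (hA : ∀ b', |A b'| ≤ cA * pek) (hK₀ : ∀ b, ∑ b', |K b b'| ≤ K₀)
    (hK₁ : ∀ p, ∑ b', |curl η⁻¹ (fun b => K b b') p| ≤ K₁) (hK₂ : ∀ x, ∑ b', |diverg η⁻¹ (fun b => K b b') x| ≤ K₂)
    (hA' : ∀ b', |A' b'| ≤ cA' * pek) (hW₀ : ∀ b, ∑ b', |W b b'| ≤ W₀)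
    (hW₁ : ∀ p, ∑ b', |curl η⁻¹ (fun b => W b b') p| ≤ W₁) (hW₂ : ∀ x, ∑ b', |diverg η⁻¹ (fun b => W b b') x| ≤ W₂) :
    Regular286 cube G ek η (c + ((K₀ * (1 + (2 + P.d) * |η⁻¹| * (N : ℝ)⁻¹) + K₁ + K₂) * cA + (W₀ + W₁ + W₂) * cA')) pek rek
      (uTilde561 ek η L Q (theta N Λ6) (fun b => ∑ b', K b b' * A b') DXf) :=
  regular286_uTilde561_of_kernels L h (abs_theta_le_one N Λ6) (lip_theta hN Λ6) (inv_nonneg.mpr (Nat.cast_nonneg N))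
    hp hr hcA hcA' hK₁' hW₁' hA hK₀ hK₁ hK₂ hA' hW₀ hW₁ hW₂

/-! ## §6  The per-bond size of `H_{k,loc}A^{(k)}` in the `→ₗ[ℝ]` currency (the shape row `C2.Eq5.9.3` consumes) -/

open Classical in
/-- **`|(H_{k,loc}A^{(k)})(b)| ≦ K₀·c_Ap(e_k)`** for `H_{k,loc}` given as a linear operator between the finite function spaces: row sums of its matrix
elements `≦ K₀` at `b` and `|A| ≦ M` give `|(TA)(b)| ≦ K₀M` (*"A^{(k)} ≦ cp(e_k) and … H_{k,loc} … bounded"* ⟹ *"θ_kH_{k,loc}A^{(k)} [is] bounded by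
cp(e_k)"*; the per-bond datum of p02's `BIJ88PassageMechanism593.passage593_datum'`). [cite: BalabanImbrieJaffe1988, (4.3) p.286] -/
theorem abs_linearMap_apply_le {α β : Type*} [Fintype β] {T : (β → ℝ) →ₗ[ℝ] (α → ℝ)} {A : β → ℝ} {M K₀ : ℝ} (hM : 0 ≤ M)
    (hA : ∀ b', |A b'| ≤ M) {b : α} (hK : ∑ b', |T (fun j => if b' = j then (1 : ℝ) else 0) b| ≤ K₀) : |T A b| ≤ K₀ * M := by
  rw [linearMap_apply_eq_kernel_sum]
  exact abs_kernel_apply_le hA hK hM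

end

end Literature.MathematicalPhysics.QuantumFieldTheory.BalabanImbrieJaffe1984to88.BIJ88RemovedFieldBounds286
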